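import Summits.QuantumFields.YangMills.Theorems.UnitScaleTiltProp7IMSDoubleCommutatorDecay
import HarnessLib

/-!
# Route `UnitScaleTilt`, crux K1 «MinimiserStabilityRegPr» (stmt-QuantumFields-19200), EX row `hGF` (curved member) — **(L4-core), PERTURBED BLOCK EDITION: THE IMS ERROR OF A
# FINE-SMOOTH CUT-OFF AGAINST A KERNEL KNOWN ONLY BY BLOCK BILINEAR BOUNDS** (sequel of ✓`Prop7IMSDoubleCommutatorDecay` §5; the edition LOCATE-L6-ASSEMBLY's Step I.1 needs for the
# nonlocal `D P D*` term once the SAME partition must be smooth on the fine scale for the local letters — bus hazard flag w5 g13 2026-08-29 23:22Z)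

Cell `ym3-torus` (HUMAN RULING D-0037, rung R3 — NOT d = 4, NOT a mass gap, NOT Clay).  Width seat `ym-ust-19200-w5` (gen 13); chair ★`ym-ust-19200-p1` g24 («(L4)(L6) w5»).  THEOREMS ONLY
(0 `def`, 0 `sorry`); `--supports stmt-QuantumFields-19200 --as helper`.  HONEST LABEL (№33 (6)): LOD-line supplier, CONDITIONAL on the member bricks; nothing of (3.49), `h349`, `hGF`, EX, the crux proved.

THE POINT.  One quadratic partition `h_b` cannot be block-constant (what the BLOCK edition ✓`norm_imsError_le_of_blockBound` wants for the `P`-sandwich) AND fine-smooth (what the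
BANDED edition ✓`Prop7IMSDoubleCommutatorRange` needs for `Δ^η`, `DD*`: a block-constant cut-off jumps by `1∕R′` across one fine bond, costing `η⁻²∕R′²` on face layers).  Cure:
`h b i = g b (blk i) + δ b i` — block-constant part `g` (jointly `ℓ`-Lipschitz in the coarse pseudo-metric `dc`) plus an in-block oscillation `δ` with `Σ_b (δ b i)² ≤ ε²` at every
index (fine-smooth cut-offs on scale `R′` blocks: `ℓ, ε = O(1∕R′)`).  Then `(h_bi − h_bk)² = (Δg)² + 2(Δg)(Δδ) + (Δδ)²` and, for a kernel `A` with BLOCK bilinear bounds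
`‖Σ_{i∈X,k∈Y} ū_i A_{ik} w_k‖ ≤ β(X,Y)·‖u_X‖·‖w_Y‖` (symmetric `β ≥ 0`; multiplying a vector by a real diagonal of the right size is all that ever happens to `u, w`):
`‖Σ_b Σ_{i,k} (h_bi − h_bk)² v̄_i A_{ik} v_k‖ ≤ (ℓ²·S₂ + 4ℓε·S₁ + 4ε²·S₀)·Σ‖v_i‖²`, `S_m := sup_X Σ_Y dc(X,Y)^m β(X,Y)` — K-uniform on its face.

WHAT IS PROVED (ns `…Theorems.Prop7IMSDoubleCommutatorPerturbedBlock`).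
* §1 `blockForm_eq_sum_blocks` (a global kernel form is the sum of its block pieces), `sum_blockCoeff_mul_eq` (block-constant coefficients), `sum_weighted_prod_le` (the real AM–GM∕Schur step over block pairs),
  `sum_normSq_diagMul_block_le` (`Σ_b ‖(δ_b•v)_X‖² ≤ ε²‖v_X‖²`), `normSq_diagSqMul_block_le` (`‖((Σ_bδ_b²)•v)_X‖ ≤ ε²‖v_X‖`).
* §2 ★★ `norm_imsErrorOsc_le` — the pure-oscillation term `(Δδ)²`: `≤ 4ε²·S₀·Σ‖v_i‖²`.
* §3 ★★ `norm_imsErrorCross_le` — the cross term `2(Δg)(Δδ)`: `≤ 4ℓε·S₁·Σ‖v_i‖²`.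
* §4 ★★★ `norm_imsError_le_of_blockBound_perturbed` (the three-term bound) and ★★★ `ims_lowerBound_of_blockBound_perturbed` (the closer, floor `σ − (ℓ²S₂ + 4ℓεS₁ + 4ε²S₀)∕2`).
WHY IT MIGHT FAIL: nothing for the algebra; member: `Σ_b δ_bi² ≤ ε²` needs the finite overlap of the cut-offs (standard half-shifted cover: `≤ 8∕R′²`).

References: B. Simon, Ann. Inst. H. Poincaré A **38** (1983) 295–308; T. Bałaban, CMP **99** (1985) 389–434 [Balaban1985BackgroundPropagators] ((3.49) p.399, Thm 3.11 p.416).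
-/

set_option autoImplicit false

noncomputable section

open scoped Matrix ComplexConjugate BigOperators
open Finset

namespace Summit.QuantumFields.YangMills.Theorems.Prop7IMSDoubleCommutatorPerturbedBlock

open Summit.QuantumFields.YangMills.Theorems.Prop7IMSDoubleCommutatorDecay (sum_eq_sum_blocks ims_lowerBound_complex norm_imsError_le_of_blockBound)

variable {n B β : Type*} [Fintype n] [Fintype B] [Fintype β] [DecidableEq β]

/-! ## §1 Block bookkeeping -/

/-- A global kernel form is the sum of its block pieces. [folklore] -/
theorem blockForm_eq_sum_blocks (A : Matrix n n ℂ) (blk : n → β) (u w : n → ℂ) :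
    ∑ i, ∑ k, star (u i) * A i k * w k
      = ∑ X, ∑ Y, ∑ i ∈ univ.filter (fun i => blk i = X), ∑ k ∈ univ.filter (fun k => blk k = Y), star (u i) * A i k * w k := by
  rw [sum_eq_sum_blocks blk]
  refine Finset.sum_congr rfl fun X _ => ?_
  have : ∀ i ∈ univ.filter (fun i => blk i = X), ∑ k, star (u i) * A i k * w k
      = ∑ Y, ∑ k ∈ univ.filter (fun k => blk k = Y), star (u i) * A i k * w k := fun i _ => sum_eq_sum_blocks blk _
  rw [Finset.sum_congr rfl this, Finset.sum_comm]

/-- Regrouping a kernel sum with BLOCK-CONSTANT coefficients: `Σ_{i,k} c(blk i, blk k)·t_{ik} = Σ_{X,Y} c(X,Y)·Σ_{i∈X,k∈Y} t_{ik}`. [folklore] -/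
theorem sum_blockCoeff_mul_eq (blk : n → β) (c : β → β → ℂ) (t : n → n → ℂ) :
    ∑ i, ∑ k, c (blk i) (blk k) * t i k
      = ∑ X, ∑ Y, c X Y * ∑ i ∈ univ.filter (fun i => blk i = X), ∑ k ∈ univ.filter (fun k => blk k = Y), t i k := by
  rw [sum_eq_sum_blocks blk]
  refine Finset.sum_congr rfl fun X _ => ?_
  have h1 : ∀ i ∈ univ.filter (fun i => blk i = X), ∑ k, c (blk i) (blk k) * t i k
      = ∑ Y, ∑ k ∈ univ.filter (fun k => blk k = Y), c X Y * t i k := by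
    intro i hi
    have hiX : blk i = X := (Finset.mem_filter.1 hi).2
    rw [sum_eq_sum_blocks blk]
    refine Finset.sum_congr rfl fun Y _ => Finset.sum_congr rfl fun k hk => ?_
    rw [hiX, (Finset.mem_filter.1 hk).2]
  rw [Finset.sum_congr rfl h1, Finset.sum_comm]
  refine Finset.sum_congr rfl fun Y _ => ?_
  rw [Finset.mul_sum]
  exact Finset.sum_congr rfl fun i _ => by rw [Finset.mul_sum]

omit [DecidableEq β] in
/-- The real AM–GM ∕ Schur step over block pairs: symmetric nonnegative weights `ω·β` with row sums `≤ S` give `Σ_{X,Y} ω β·(a_X b_Y) ≤ S·(Σ a² + Σ b²)∕2`. [folklore] -/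
theorem sum_weighted_prod_le (ω βb : β → β → ℝ) (hωs : ∀ X Y, ω X Y = ω Y X) (hβs : ∀ X Y, βb X Y = βb Y X)
    (hω0 : ∀ X Y, 0 ≤ ω X Y) (hβ0 : ∀ X Y, 0 ≤ βb X Y) {S : ℝ} (hS : ∀ X, ∑ Y, ω X Y * βb X Y ≤ S) (a b : β → ℝ) :
    ∑ X, ∑ Y, ω X Y * βb X Y * (a X * b Y) ≤ S * ((∑ X, a X ^ 2) + ∑ X, b X ^ 2) / 2 := by
  have h1 : ∀ X Y, ω X Y * βb X Y * (a X * b Y) ≤ ω X Y * βb X Y * ((a X ^ 2 + b Y ^ 2) / 2) := fun X Y =>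
    mul_le_mul_of_nonneg_left (by nlinarith [sq_nonneg (a X - b Y)]) (mul_nonneg (hω0 X Y) (hβ0 X Y))
  calc ∑ X, ∑ Y, ω X Y * βb X Y * (a X * b Y)
      ≤ ∑ X, ∑ Y, ω X Y * βb X Y * ((a X ^ 2 + b Y ^ 2) / 2) := Finset.sum_le_sum fun X _ => Finset.sum_le_sum fun Y _ => h1 X Y
    _ = (∑ X, (∑ Y, ω X Y * βb X Y) * a X ^ 2) / 2 + (∑ Y, (∑ X, ω X Y * βb X Y) * b Y ^ 2) / 2 := by
        have e : ∀ X Y, ω X Y * βb X Y * ((a X ^ 2 + b Y ^ 2) / 2) = ω X Y * βb X Y * a X ^ 2 / 2 + ω X Y * βb X Y * b Y ^ 2 / 2 := fun X Y => by ring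
        simp only [e, Finset.sum_add_distrib, Finset.sum_div, Finset.sum_mul]
        congr 1
        rw [Finset.sum_comm]
    _ ≤ (∑ X, S * a X ^ 2) / 2 + (∑ Y, S * b Y ^ 2) / 2 := by
        have hcol : ∀ Y, ∑ X, ω X Y * βb X Y ≤ S := fun Y => by
          have : ∑ X, ω X Y * βb X Y = ∑ X, ω Y X * βb Y X := Finset.sum_congr rfl fun X _ => by rw [hωs X Y, hβs X Y]
          rw [this]; exact hS Y
        gcongr with X _ Y _
        · exact hS X
        · exact hcol Y
    _ = S * ((∑ X, a X ^ 2) + ∑ X, b X ^ 2) / 2 := by rw [← Finset.mul_sum, ← Finset.mul_sum]; ring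

omit [Fintype n] in
/-- `Σ_b ‖(δ_b•v)_X‖² ≤ ε²·‖v_X‖²` when `Σ_b (δ b i)² ≤ ε²` at every index (block-restricted sums). [folklore] -/
theorem sum_normSq_diagMul_block_le (δ : B → n → ℝ) {ε : ℝ} (hδ : ∀ i, ∑ b, δ b i ^ 2 ≤ ε ^ 2) (v : n → ℂ) (s : Finset n) :
    ∑ b, ∑ i ∈ s, ‖((δ b i : ℝ) : ℂ) * v i‖ ^ 2 ≤ ε ^ 2 * ∑ i ∈ s, ‖v i‖ ^ 2 := by
  rw [Finset.sum_comm, Finset.mul_sum]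
  refine Finset.sum_le_sum fun i _ => ?_
  have : ∀ b, ‖((δ b i : ℝ) : ℂ) * v i‖ ^ 2 = δ b i ^ 2 * ‖v i‖ ^ 2 := fun b => by
    rw [norm_mul, mul_pow, Complex.norm_real, Real.norm_eq_abs, sq_abs]
  simp only [this]
  rw [← Finset.sum_mul]
  exact mul_le_mul_of_nonneg_right (hδ i) (sq_nonneg _)

omit [Fintype n] in
/-- `‖((Σ_b δ_b²)•v)_X‖² ≤ (ε²)²·‖v_X‖²` when `Σ_b (δ b i)² ≤ ε²` at every index. [folklore] -/
theorem normSq_diagSqMul_block_le (δ : B → n → ℝ) {ε : ℝ} (hδ : ∀ i, ∑ b, δ b i ^ 2 ≤ ε ^ 2) (v : n → ℂ) (s : Finset n) :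
    ∑ i ∈ s, ‖(((∑ b, δ b i ^ 2 : ℝ)) : ℂ) * v i‖ ^ 2 ≤ (ε ^ 2) ^ 2 * ∑ i ∈ s, ‖v i‖ ^ 2 := by
  rw [Finset.mul_sum]
  refine Finset.sum_le_sum fun i _ => ?_
  rw [norm_mul, mul_pow, Complex.norm_real, Real.norm_eq_abs, abs_of_nonneg (Finset.sum_nonneg fun b _ => sq_nonneg _)]
  exact mul_le_mul_of_nonneg_right (pow_le_pow_left₀ (Finset.sum_nonneg fun b _ => sq_nonneg _) (hδ i) 2) (sq_nonneg _)

/-! ## §2 The pure-oscillation term -/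

/-- ★★ **THE PURE-OSCILLATION TERM**: with `(D•v)_i := (Σ_b δ_bi²)·v_i` and `(δ_b•v)_i := δ_bi·v_i`,
`Σ_b Σ_{i,k} (δ_bi − δ_bk)²·v̄_i A_{ik} v_k = G(D•v, v) + G(v, D•v) − 2Σ_b G(δ_b•v, δ_b•v)` (`G` the global kernel form), and each piece is a sum of block pieces bounded by
`β(X,Y)·‖·_X‖·‖·_Y‖`; with `Σ_b δ_bi² ≤ ε²`: `‖…‖ ≤ 4ε²·S₀·Σ‖v_i‖²`, `S₀ = sup_X Σ_Y β(X,Y)`. [cite: Balaban1985BackgroundPropagators, (3.49) p.399] -/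
theorem norm_imsErrorOsc_le (A : Matrix n n ℂ) (blk : n → β) (δ : B → n → ℝ)
    (βb : β → β → ℝ) (hβs : ∀ X Y, βb X Y = βb Y X) (hβ0 : ∀ X Y, 0 ≤ βb X Y) {ε S₀ : ℝ} (hε : 0 ≤ ε)
    (hδ : ∀ i, ∑ b, δ b i ^ 2 ≤ ε ^ 2)
    (hA : ∀ (X Y : β) (u w : n → ℂ),
      ‖∑ i ∈ univ.filter (fun i => blk i = X), ∑ k ∈ univ.filter (fun k => blk k = Y), star (u i) * A i k * w k‖
        ≤ βb X Y * Real.sqrt (∑ i ∈ univ.filter (fun i => blk i = X), ‖u i‖ ^ 2) * Real.sqrt (∑ k ∈ univ.filter (fun k => blk k = Y), ‖w k‖ ^ 2))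
    (hS : ∀ X, ∑ Y, βb X Y ≤ S₀) (v : n → ℂ) :
    ‖∑ b, ∑ i, ∑ k, (((δ b i - δ b k) ^ 2 : ℝ) : ℂ) * (star (v i) * A i k * v k)‖ ≤ 4 * ε ^ 2 * S₀ * ∑ i, ‖v i‖ ^ 2 := by
  classical
  set fib : β → Finset n := fun X => univ.filter (fun i => blk i = X) with hfib
  set a : β → ℝ := fun X => Real.sqrt (∑ i ∈ fib X, ‖v i‖ ^ 2) with ha
  set F : β → β → (n → ℂ) → (n → ℂ) → ℂ := fun X Y u w => ∑ i ∈ fib X, ∑ k ∈ fib Y, star (u i) * A i k * w k with hF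
  set Dv : n → ℂ := fun i => (((∑ b, δ b i ^ 2 : ℝ)) : ℂ) * v i with hDv
  set dv : B → n → ℂ := fun b i => ((δ b i : ℝ) : ℂ) * v i with hdv
  have ha0 : ∀ X, 0 ≤ a X := fun X => Real.sqrt_nonneg _
  have ha2 : ∀ X, a X ^ 2 = ∑ i ∈ fib X, ‖v i‖ ^ 2 := fun X => Real.sq_sqrt (Finset.sum_nonneg fun i _ => sq_nonneg _)
  have hsuma : ∑ X, a X ^ 2 = ∑ i, ‖v i‖ ^ 2 := by
    rw [sum_eq_sum_blocks blk (fun i => ‖v i‖ ^ 2)]; exact Finset.sum_congr rfl fun X _ => ha2 X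
  -- block norms of the scaled vectors
  have hDvX : ∀ X, Real.sqrt (∑ i ∈ fib X, ‖Dv i‖ ^ 2) ≤ ε ^ 2 * a X := fun X => by
    rw [ha, ← Real.sqrt_sq (sq_nonneg ε), ← Real.sqrt_mul (sq_nonneg _)]
    exact Real.sqrt_le_sqrt (by rw [hDv]; exact normSq_diagSqMul_block_le δ hδ v (fib X))
  have hdvX : ∀ X, ∑ b, Real.sqrt (∑ i ∈ fib X, ‖dv b i‖ ^ 2) ^ 2 ≤ ε ^ 2 * a X ^ 2 := fun X => by
    have : ∀ b, Real.sqrt (∑ i ∈ fib X, ‖dv b i‖ ^ 2) ^ 2 = ∑ i ∈ fib X, ‖dv b i‖ ^ 2 := fun b => Real.sq_sqrt (Finset.sum_nonneg fun i _ => sq_nonneg _)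
    simp only [this, ha2]
    exact sum_normSq_diagMul_block_le δ hδ v (fib X)
  -- STEP 1: the identity `Σ_b Σ_{ik} (δ_bi − δ_bk)² s_ik = G(Dv,v) + G(v,Dv) − 2 Σ_b G(dv_b, dv_b)`
  have hid : ∑ b, ∑ i, ∑ k, (((δ b i - δ b k) ^ 2 : ℝ) : ℂ) * (star (v i) * A i k * v k)
      = (∑ i, ∑ k, star (Dv i) * A i k * v k) + (∑ i, ∑ k, star (v i) * A i k * Dv k)
        - 2 * ∑ b, ∑ i, ∑ k, star (dv b i) * A i k * dv b k := by
    have e1 : ∀ b i k, (((δ b i - δ b k) ^ 2 : ℝ) : ℂ) * (star (v i) * A i k * v k)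
        = ((δ b i ^ 2 : ℝ) : ℂ) * (star (v i) * A i k * v k) + ((δ b k ^ 2 : ℝ) : ℂ) * (star (v i) * A i k * v k)
          - 2 * (star (dv b i) * A i k * dv b k) := by
      intro b i k
      rw [hdv]
      simp only [star_mul', Complex.star_def, Complex.conj_ofReal]
      push_cast
      ring
    simp only [e1, Finset.sum_sub_distrib, Finset.sum_add_distrib, Finset.mul_sum]
    congr 1
    congr 1
    · -- `Σ_b Σ_i Σ_k δ_bi² s_ik = Σ_i Σ_k star(Dv i) …`
      rw [Finset.sum_comm]
      refine Finset.sum_congr rfl fun i _ => ?_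
      rw [Finset.sum_comm]
      refine Finset.sum_congr rfl fun k _ => ?_
      rw [← Finset.sum_mul, hDv]
      simp only [star_mul', Complex.star_def, Complex.conj_ofReal]
      push_cast
      ring
    · rw [Finset.sum_comm]
      refine Finset.sum_congr rfl fun i _ => ?_
      rw [Finset.sum_comm]
      refine Finset.sum_congr rfl fun k _ => ?_
      rw [← Finset.sum_mul, hDv]
      push_cast
      ring
  rw [hid]
  -- STEP 2: block bounds for the three global forms
  have hG : ∀ u w : n → ℂ, ‖∑ i, ∑ k, star (u i) * A i k * w k‖
      ≤ ∑ X, ∑ Y, βb X Y * (Real.sqrt (∑ i ∈ fib X, ‖u i‖ ^ 2) * Real.sqrt (∑ k ∈ fib Y, ‖w k‖ ^ 2)) := by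
    intro u w
    rw [blockForm_eq_sum_blocks A blk u w]
    refine (norm_sum_le _ _).trans (Finset.sum_le_sum fun X _ => (norm_sum_le _ _).trans (Finset.sum_le_sum fun Y _ => ?_))
    have := hA X Y u w
    rw [mul_assoc] at this
    exact this
  -- (i) `G(Dv, v)` and (ii) `G(v, Dv)`
  have h1 : ‖∑ i, ∑ k, star (Dv i) * A i k * v k‖ ≤ ε ^ 2 * S₀ * ∑ i, ‖v i‖ ^ 2 := by
    refine (hG Dv v).trans ?_
    calc ∑ X, ∑ Y, βb X Y * (Real.sqrt (∑ i ∈ fib X, ‖Dv i‖ ^ 2) * Real.sqrt (∑ k ∈ fib Y, ‖v k‖ ^ 2))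
        ≤ ∑ X, ∑ Y, 1 * βb X Y * ((ε ^ 2 * a X) * a Y) := by
          refine Finset.sum_le_sum fun X _ => Finset.sum_le_sum fun Y _ => ?_
          rw [one_mul]
          exact mul_le_mul_of_nonneg_left (mul_le_mul (hDvX X) le_rfl (ha0 Y) (by have := ha0 X; positivity)) (hβ0 X Y)
      _ = ε ^ 2 * ∑ X, ∑ Y, 1 * βb X Y * (a X * a Y) := by
          rw [Finset.mul_sum]; refine Finset.sum_congr rfl fun X _ => ?_
          rw [Finset.mul_sum]; exact Finset.sum_congr rfl fun Y _ => by ring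
      _ ≤ ε ^ 2 * (S₀ * ((∑ X, a X ^ 2) + ∑ X, a X ^ 2) / 2) :=
          mul_le_mul_of_nonneg_left (sum_weighted_prod_le (fun _ _ => (1 : ℝ)) βb (fun _ _ => rfl) hβs (fun _ _ => zero_le_one) hβ0
            (fun X => by simpa only [one_mul] using hS X) a a) (sq_nonneg _)
      _ = ε ^ 2 * S₀ * ∑ i, ‖v i‖ ^ 2 := by rw [hsuma]; ring
  have h2 : ‖∑ i, ∑ k, star (v i) * A i k * Dv k‖ ≤ ε ^ 2 * S₀ * ∑ i, ‖v i‖ ^ 2 := by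
    refine (hG v Dv).trans ?_
    calc ∑ X, ∑ Y, βb X Y * (Real.sqrt (∑ i ∈ fib X, ‖v i‖ ^ 2) * Real.sqrt (∑ k ∈ fib Y, ‖Dv k‖ ^ 2))
        ≤ ∑ X, ∑ Y, 1 * βb X Y * (a X * (ε ^ 2 * a Y)) := by
          refine Finset.sum_le_sum fun X _ => Finset.sum_le_sum fun Y _ => ?_
          rw [one_mul]
          exact mul_le_mul_of_nonneg_left (mul_le_mul le_rfl (hDvX Y) (Real.sqrt_nonneg _) (ha0 X)) (hβ0 X Y)
      _ = ε ^ 2 * ∑ X, ∑ Y, 1 * βb X Y * (a X * a Y) := by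
          rw [Finset.mul_sum]; refine Finset.sum_congr rfl fun X _ => ?_
          rw [Finset.mul_sum]; exact Finset.sum_congr rfl fun Y _ => by ring
      _ ≤ ε ^ 2 * (S₀ * ((∑ X, a X ^ 2) + ∑ X, a X ^ 2) / 2) :=
          mul_le_mul_of_nonneg_left (sum_weighted_prod_le (fun _ _ => (1 : ℝ)) βb (fun _ _ => rfl) hβs (fun _ _ => zero_le_one) hβ0
            (fun X => by simpa only [one_mul] using hS X) a a) (sq_nonneg _)
      _ = ε ^ 2 * S₀ * ∑ i, ‖v i‖ ^ 2 := by rw [hsuma]; ring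
  -- (iii) `Σ_b G(dv_b, dv_b)`: Cauchy–Schwarz in `b` per block pair
  have h3 : ‖∑ b, ∑ i, ∑ k, star (dv b i) * A i k * dv b k‖ ≤ ε ^ 2 * S₀ * ∑ i, ‖v i‖ ^ 2 := by
    refine (norm_sum_le _ _).trans ?_
    refine (Finset.sum_le_sum fun b _ => hG (dv b) (dv b)).trans ?_
    rw [Finset.sum_comm]
    -- per `X`: swap `Σ_b` and `Σ_Y`, then Cauchy–Schwarz in `b`
    have hcs : ∀ X Y, ∑ b, βb X Y * (Real.sqrt (∑ i ∈ fib X, ‖dv b i‖ ^ 2) * Real.sqrt (∑ k ∈ fib Y, ‖dv b k‖ ^ 2))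
        ≤ 1 * βb X Y * ((ε * a X) * (ε * a Y)) := by
      intro X Y
      rw [← Finset.mul_sum, one_mul]
      refine mul_le_mul_of_nonneg_left ?_ (hβ0 X Y)
      -- `Σ_b p_b q_b ≤ √(Σ p_b²) √(Σ q_b²) ≤ (ε a_X)(ε a_Y)`
      have hCS := Real.sum_mul_le_sqrt_mul_sqrt (Finset.univ : Finset B)
        (fun b => Real.sqrt (∑ i ∈ fib X, ‖dv b i‖ ^ 2)) (fun b => Real.sqrt (∑ k ∈ fib Y, ‖dv b k‖ ^ 2))
      refine hCS.trans ?_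
      have hp : Real.sqrt (∑ b, Real.sqrt (∑ i ∈ fib X, ‖dv b i‖ ^ 2) ^ 2) ≤ ε * a X := by
        rw [← Real.sqrt_sq (mul_nonneg hε (ha0 X)), mul_pow]
        exact Real.sqrt_le_sqrt (hdvX X)
      have hq : Real.sqrt (∑ b, Real.sqrt (∑ k ∈ fib Y, ‖dv b k‖ ^ 2) ^ 2) ≤ ε * a Y := by
        rw [← Real.sqrt_sq (mul_nonneg hε (ha0 Y)), mul_pow]
        exact Real.sqrt_le_sqrt (hdvX Y)
      exact mul_le_mul hp hq (Real.sqrt_nonneg _) (mul_nonneg hε (ha0 X))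
    calc ∑ X, ∑ b, ∑ Y, βb X Y * (Real.sqrt (∑ i ∈ fib X, ‖dv b i‖ ^ 2) * Real.sqrt (∑ k ∈ fib Y, ‖dv b k‖ ^ 2))
        = ∑ X, ∑ Y, ∑ b, βb X Y * (Real.sqrt (∑ i ∈ fib X, ‖dv b i‖ ^ 2) * Real.sqrt (∑ k ∈ fib Y, ‖dv b k‖ ^ 2)) :=
          Finset.sum_congr rfl fun X _ => Finset.sum_comm
      _ ≤ ∑ X, ∑ Y, 1 * βb X Y * ((ε * a X) * (ε * a Y)) := Finset.sum_le_sum fun X _ => Finset.sum_le_sum fun Y _ => hcs X Y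
      _ = ε ^ 2 * ∑ X, ∑ Y, 1 * βb X Y * (a X * a Y) := by
          rw [Finset.mul_sum]; refine Finset.sum_congr rfl fun X _ => ?_
          rw [Finset.mul_sum]; exact Finset.sum_congr rfl fun Y _ => by ring
      _ ≤ ε ^ 2 * (S₀ * ((∑ X, a X ^ 2) + ∑ X, a X ^ 2) / 2) :=
          mul_le_mul_of_nonneg_left (sum_weighted_prod_le (fun _ _ => (1 : ℝ)) βb (fun _ _ => rfl) hβs (fun _ _ => zero_le_one) hβ0
            (fun X => by simpa only [one_mul] using hS X) a a) (sq_nonneg _)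
      _ = ε ^ 2 * S₀ * ∑ i, ‖v i‖ ^ 2 := by rw [hsuma]; ring
  calc ‖(∑ i, ∑ k, star (Dv i) * A i k * v k) + (∑ i, ∑ k, star (v i) * A i k * Dv k) - 2 * ∑ b, ∑ i, ∑ k, star (dv b i) * A i k * dv b k‖
      ≤ ‖∑ i, ∑ k, star (Dv i) * A i k * v k‖ + ‖∑ i, ∑ k, star (v i) * A i k * Dv k‖ + 2 * ‖∑ b, ∑ i, ∑ k, star (dv b i) * A i k * dv b k‖ := by
        refine (norm_sub_le _ _).trans (add_le_add (norm_add_le _ _) ?_)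
        rw [norm_mul, Complex.norm_ofNat]
    _ ≤ 4 * ε ^ 2 * S₀ * ∑ i, ‖v i‖ ^ 2 := by linarith [h1, h2, h3]

/-! ## §3 The cross term -/

/-- ★★ **THE CROSS TERM**: for block-constant `ḡ_bi = g b (blk i)` and in-block oscillations `δ`,
`Σ_b Σ_{i,k} (ḡ_bi − ḡ_bk)(δ_bi − δ_bk)·v̄_i A_{ik} v_k = Σ_b Σ_{X,Y} (g_bX − g_bY)·(F_{XY}(δ_b•v, v) − F_{XY}(v, δ_b•v))` (`F_{XY}` the block pieces of the kernel form);
Cauchy–Schwarz in `b` per block pair (`Σ_b (g_bX − g_bY)² ≤ ℓ²dc(X,Y)²`, `Σ_b ‖(δ_b•v)_X‖² ≤ ε²‖v_X‖²`) and the Schur step with the FIRST moment give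
`‖…‖ ≤ 2ℓε·S₁·Σ‖v_i‖²`, `S₁ = sup_X Σ_Y dc(X,Y)·β(X,Y)`. [cite: Balaban1985BackgroundPropagators, (3.49) p.399] -/
theorem norm_imsErrorCross_le (A : Matrix n n ℂ) (blk : n → β) (g : B → β → ℝ) (δ : B → n → ℝ)
    (dc βb : β → β → ℝ) (hβs : ∀ X Y, βb X Y = βb Y X) (hβ0 : ∀ X Y, 0 ≤ βb X Y) (hdcs : ∀ X Y, dc X Y = dc Y X) (hdc0 : ∀ X Y, 0 ≤ dc X Y)
    {ℓ ε S₁ : ℝ} (hℓ : 0 ≤ ℓ) (hε : 0 ≤ ε)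
    (hLip : ∀ X Y, ∑ b, (g b X - g b Y) ^ 2 ≤ ℓ ^ 2 * dc X Y ^ 2) (hδ : ∀ i, ∑ b, δ b i ^ 2 ≤ ε ^ 2)
    (hA : ∀ (X Y : β) (u w : n → ℂ),
      ‖∑ i ∈ univ.filter (fun i => blk i = X), ∑ k ∈ univ.filter (fun k => blk k = Y), star (u i) * A i k * w k‖
        ≤ βb X Y * Real.sqrt (∑ i ∈ univ.filter (fun i => blk i = X), ‖u i‖ ^ 2) * Real.sqrt (∑ k ∈ univ.filter (fun k => blk k = Y), ‖w k‖ ^ 2))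
    (hS : ∀ X, ∑ Y, dc X Y * βb X Y ≤ S₁) (v : n → ℂ) :
    ‖∑ b, ∑ i, ∑ k, (((g b (blk i) - g b (blk k)) * (δ b i - δ b k) : ℝ) : ℂ) * (star (v i) * A i k * v k)‖ ≤ 2 * ℓ * ε * S₁ * ∑ i, ‖v i‖ ^ 2 := by
  classical
  set fib : β → Finset n := fun X => univ.filter (fun i => blk i = X) with hfib
  set a : β → ℝ := fun X => Real.sqrt (∑ i ∈ fib X, ‖v i‖ ^ 2) with ha
  set F : β → β → (n → ℂ) → (n → ℂ) → ℂ := fun X Y u w => ∑ i ∈ fib X, ∑ k ∈ fib Y, star (u i) * A i k * w k with hF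
  set dv : B → n → ℂ := fun b i => ((δ b i : ℝ) : ℂ) * v i with hdv
  set p : B → β → ℝ := fun b X => Real.sqrt (∑ i ∈ fib X, ‖dv b i‖ ^ 2) with hp
  have ha0 : ∀ X, 0 ≤ a X := fun X => Real.sqrt_nonneg _
  have hp0 : ∀ b X, 0 ≤ p b X := fun b X => Real.sqrt_nonneg _
  have ha2 : ∀ X, a X ^ 2 = ∑ i ∈ fib X, ‖v i‖ ^ 2 := fun X => Real.sq_sqrt (Finset.sum_nonneg fun i _ => sq_nonneg _)
  have hsuma : ∑ X, a X ^ 2 = ∑ i, ‖v i‖ ^ 2 := by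
    rw [sum_eq_sum_blocks blk (fun i => ‖v i‖ ^ 2)]; exact Finset.sum_congr rfl fun X _ => ha2 X
  have hpX : ∀ X, ∑ b, p b X ^ 2 ≤ ε ^ 2 * a X ^ 2 := fun X => by
    have : ∀ b, p b X ^ 2 = ∑ i ∈ fib X, ‖dv b i‖ ^ 2 := fun b => Real.sq_sqrt (Finset.sum_nonneg fun i _ => sq_nonneg _)
    simp only [this, ha2]
    exact sum_normSq_diagMul_block_le δ hδ v (fib X)
  -- Cauchy–Schwarz in `b`: `Σ_b |g_bX − g_bY|·p_b(Z) ≤ ℓ·dc(X,Y)·(ε·a_Z)`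
  have hCS : ∀ X Y Z, ∑ b, |g b X - g b Y| * p b Z ≤ ℓ * dc X Y * (ε * a Z) := by
    intro X Y Z
    refine (Real.sum_mul_le_sqrt_mul_sqrt _ _ _).trans ?_
    have h1 : Real.sqrt (∑ b, |g b X - g b Y| ^ 2) ≤ ℓ * dc X Y := by
      rw [← Real.sqrt_sq (mul_nonneg hℓ (hdc0 X Y)), mul_pow]
      exact Real.sqrt_le_sqrt (by simpa only [sq_abs] using hLip X Y)
    have h2 : Real.sqrt (∑ b, p b Z ^ 2) ≤ ε * a Z := by
      rw [← Real.sqrt_sq (mul_nonneg hε (ha0 Z)), mul_pow]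
      exact Real.sqrt_le_sqrt (hpX Z)
    exact mul_le_mul h1 h2 (Real.sqrt_nonneg _) (mul_nonneg hℓ (hdc0 X Y))
  -- STEP 1: the identity
  have hid : ∑ b, ∑ i, ∑ k, (((g b (blk i) - g b (blk k)) * (δ b i - δ b k) : ℝ) : ℂ) * (star (v i) * A i k * v k)
      = ∑ b, ∑ X, ∑ Y, ((g b X - g b Y : ℝ) : ℂ) * (F X Y (dv b) v - F X Y v (dv b)) := by
    refine Finset.sum_congr rfl fun b _ => ?_
    have e1 : ∀ i k, (((g b (blk i) - g b (blk k)) * (δ b i - δ b k) : ℝ) : ℂ) * (star (v i) * A i k * v k)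
        = ((g b (blk i) - g b (blk k) : ℝ) : ℂ) * (star (dv b i) * A i k * v k - star (v i) * A i k * dv b k) := by
      intro i k
      rw [hdv]
      simp only [star_mul', Complex.star_def, Complex.conj_ofReal]
      push_cast
      ring
    simp only [e1]
    rw [sum_blockCoeff_mul_eq blk (fun X Y => ((g b X - g b Y : ℝ) : ℂ)) (fun i k => star (dv b i) * A i k * v k - star (v i) * A i k * dv b k)]
    refine Finset.sum_congr rfl fun X _ => Finset.sum_congr rfl fun Y _ => ?_
    simp only [hF, hfib, Finset.sum_sub_distrib]
  rw [hid]
  -- STEP 2: the bound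
  calc ‖∑ b, ∑ X, ∑ Y, ((g b X - g b Y : ℝ) : ℂ) * (F X Y (dv b) v - F X Y v (dv b))‖
      ≤ ∑ b, ∑ X, ∑ Y, |g b X - g b Y| * (βb X Y * p b X * a Y + βb X Y * a X * p b Y) := by
        refine (norm_sum_le _ _).trans (Finset.sum_le_sum fun b _ => (norm_sum_le _ _).trans (Finset.sum_le_sum fun X _ =>
          (norm_sum_le _ _).trans (Finset.sum_le_sum fun Y _ => ?_)))
        rw [norm_mul, Complex.norm_real, Real.norm_eq_abs]
        refine mul_le_mul_of_nonneg_left ((norm_sub_le _ _).trans (add_le_add ?_ ?_)) (abs_nonneg _)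
        · exact hA X Y (dv b) v
        · exact hA X Y v (dv b)
    _ = ∑ X, ∑ Y, βb X Y * ((∑ b, |g b X - g b Y| * p b X) * a Y + a X * ∑ b, |g b X - g b Y| * p b Y) := by
        rw [Finset.sum_comm]
        refine Finset.sum_congr rfl fun X _ => ?_
        rw [Finset.sum_comm]
        refine Finset.sum_congr rfl fun Y _ => ?_
        rw [Finset.sum_mul, Finset.mul_sum, ← Finset.sum_add_distrib, Finset.mul_sum]
        exact Finset.sum_congr rfl fun b _ => by ring
    _ ≤ ∑ X, ∑ Y, βb X Y * ((ℓ * dc X Y * (ε * a X)) * a Y + a X * (ℓ * dc X Y * (ε * a Y))) := by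
        refine Finset.sum_le_sum fun X _ => Finset.sum_le_sum fun Y _ => mul_le_mul_of_nonneg_left ?_ (hβ0 X Y)
        exact add_le_add (mul_le_mul_of_nonneg_right (hCS X Y X) (ha0 Y)) (mul_le_mul_of_nonneg_left (hCS X Y Y) (ha0 X))
    _ = 2 * ℓ * ε * ∑ X, ∑ Y, dc X Y * βb X Y * (a X * a Y) := by
        rw [Finset.mul_sum]; refine Finset.sum_congr rfl fun X _ => ?_
        rw [Finset.mul_sum]; exact Finset.sum_congr rfl fun Y _ => by ring
    _ ≤ 2 * ℓ * ε * (S₁ * ((∑ X, a X ^ 2) + ∑ X, a X ^ 2) / 2) :=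
        mul_le_mul_of_nonneg_left (sum_weighted_prod_le dc βb hdcs hβs hdc0 hβ0 hS a a) (by positivity)
    _ = 2 * ℓ * ε * S₁ * ∑ i, ‖v i‖ ^ 2 := by rw [hsuma]; ring

/-! ## §4 The three-term bound and the closer -/

/-- ★★★ **THE IMS ERROR OF A PERTURBED BLOCK-CONSTANT PARTITION AGAINST BLOCK BILINEAR BOUNDS.**  Cut-offs `h b i = g b (blk i) + δ b i`: block-constant part `g`
jointly `ℓ`-Lipschitz in the coarse pseudo-metric (`Σ_b (g b X − g b Y)² ≤ ℓ²·dc(X,Y)²`, `dc ≥ 0` symmetric), in-block oscillation with `Σ_b (δ b i)² ≤ ε²` at every index; a kernel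
`A` with BLOCK bilinear bounds `β(X,Y)` (symmetric, `≥ 0`) and moments `Σ_Y dc^m β ≤ S_m` (`m = 0,1,2`).  Then
`‖Σ_b Σ_{i,k} (h_bi − h_bk)²·v̄_i A_{ik} v_k‖ ≤ (ℓ²·S₂ + 4ℓε·S₁ + 4ε²·S₀)·Σ‖v_i‖²` — `(Δg)²` by the BLOCK edition ✓`norm_imsError_le_of_blockBound`, `2(Δg)(Δδ)` by
`norm_imsErrorCross_le`, `(Δδ)²` by `norm_imsErrorOsc_le`.  (Member reading, LOD line Step I.1: fine-smooth cut-offs on scale-`R′` unit blocks have `ℓ, ε = O(1∕R′)`, so all three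
terms are `O(R′⁻²)·S_m`, K-uniform; the LOCAL letters `Δ^η`, `DD*` use the banded edition ✓`Prop7IMSDoubleCommutatorRange` with the fine Lipschitz constant instead.)
[cite: Balaban1985BackgroundPropagators, (3.49) p.399, Thm 3.11 p.416] -/
theorem norm_imsError_le_of_blockBound_perturbed (A : Matrix n n ℂ) (blk : n → β) (g : B → β → ℝ) (δ : B → n → ℝ)
    (dc βb : β → β → ℝ) (hβs : ∀ X Y, βb X Y = βb Y X) (hβ0 : ∀ X Y, 0 ≤ βb X Y) (hdcs : ∀ X Y, dc X Y = dc Y X) (hdc0 : ∀ X Y, 0 ≤ dc X Y)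
    {ℓ ε S₀ S₁ S₂ : ℝ} (hℓ : 0 ≤ ℓ) (hε : 0 ≤ ε)
    (hLip : ∀ X Y, ∑ b, (g b X - g b Y) ^ 2 ≤ ℓ ^ 2 * dc X Y ^ 2) (hδ : ∀ i, ∑ b, δ b i ^ 2 ≤ ε ^ 2)
    (hA : ∀ (X Y : β) (u w : n → ℂ),
      ‖∑ i ∈ univ.filter (fun i => blk i = X), ∑ k ∈ univ.filter (fun k => blk k = Y), star (u i) * A i k * w k‖
        ≤ βb X Y * Real.sqrt (∑ i ∈ univ.filter (fun i => blk i = X), ‖u i‖ ^ 2) * Real.sqrt (∑ k ∈ univ.filter (fun k => blk k = Y), ‖w k‖ ^ 2))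
    (hS0 : ∀ X, ∑ Y, βb X Y ≤ S₀) (hS1 : ∀ X, ∑ Y, dc X Y * βb X Y ≤ S₁) (hS2 : ∀ X, ∑ Y, dc X Y ^ 2 * βb X Y ≤ S₂) (v : n → ℂ) :
    ‖∑ b, ∑ i, ∑ k, (((g b (blk i) + δ b i - (g b (blk k) + δ b k)) ^ 2 : ℝ) : ℂ) * (star (v i) * A i k * v k)‖
      ≤ (ℓ ^ 2 * S₂ + 4 * ℓ * ε * S₁ + 4 * ε ^ 2 * S₀) * ∑ i, ‖v i‖ ^ 2 := by
  have e1 : ∀ b i k, (((g b (blk i) + δ b i - (g b (blk k) + δ b k)) ^ 2 : ℝ) : ℂ) * (star (v i) * A i k * v k)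
      = (((g b (blk i) - g b (blk k)) ^ 2 : ℝ) : ℂ) * (star (v i) * A i k * v k)
        + 2 * ((((g b (blk i) - g b (blk k)) * (δ b i - δ b k) : ℝ) : ℂ) * (star (v i) * A i k * v k))
        + (((δ b i - δ b k) ^ 2 : ℝ) : ℂ) * (star (v i) * A i k * v k) := by
    intro b i k; push_cast; ring
  simp only [e1, Finset.sum_add_distrib, ← Finset.mul_sum]
  have h1 := norm_imsError_le_of_blockBound A blk g dc βb hβs hβ0 hdcs hLip hA hS2 v
  have h2 := norm_imsErrorCross_le A blk g δ dc βb hβs hβ0 hdcs hdc0 hℓ hε hLip hδ hA hS1 v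
  have h3 := norm_imsErrorOsc_le A blk δ βb hβs hβ0 hε hδ hA hS0 v
  calc ‖(∑ b, ∑ i, ∑ k, (((g b (blk i) - g b (blk k)) ^ 2 : ℝ) : ℂ) * (star (v i) * A i k * v k))
        + 2 * (∑ b, ∑ i, ∑ k, (((g b (blk i) - g b (blk k)) * (δ b i - δ b k) : ℝ) : ℂ) * (star (v i) * A i k * v k))
        + ∑ b, ∑ i, ∑ k, (((δ b i - δ b k) ^ 2 : ℝ) : ℂ) * (star (v i) * A i k * v k)‖
      ≤ ‖∑ b, ∑ i, ∑ k, (((g b (blk i) - g b (blk k)) ^ 2 : ℝ) : ℂ) * (star (v i) * A i k * v k)‖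
        + 2 * ‖∑ b, ∑ i, ∑ k, (((g b (blk i) - g b (blk k)) * (δ b i - δ b k) : ℝ) : ℂ) * (star (v i) * A i k * v k)‖
        + ‖∑ b, ∑ i, ∑ k, (((δ b i - δ b k) ^ 2 : ℝ) : ℂ) * (star (v i) * A i k * v k)‖ := by
        refine (norm_add_le _ _).trans (add_le_add ((norm_add_le _ _).trans (add_le_add le_rfl ?_)) le_rfl)
        rw [norm_mul, Complex.norm_ofNat]
    _ ≤ (ℓ ^ 2 * S₂ + 4 * ℓ * ε * S₁ + 4 * ε ^ 2 * S₀) * ∑ i, ‖v i‖ ^ 2 := by linarith [h1, h2, h3]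

/-- ★★★ **THE CLOSER (PERTURBED BLOCK EDITION)**: a quadratic partition `Σ_b (g b (blk i) + δ b i)² = 1`, uniform local floors `σ` on the supports, and the data of
`norm_imsError_le_of_blockBound_perturbed` give the GLOBAL floor `σ − (ℓ²S₂ + 4ℓεS₁ + 4ε²S₀)∕2` — via ✓`ims_lowerBound_complex`.
[cite: Balaban1985BackgroundPropagators, (3.49) p.399, Thm 3.11 p.416] -/
theorem ims_lowerBound_of_blockBound_perturbed (A : Matrix n n ℂ) (blk : n → β) (g : B → β → ℝ) (δ : B → n → ℝ)
    (hpart : ∀ i, ∑ b, (g b (blk i) + δ b i) ^ 2 = 1)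
    (dc βb : β → β → ℝ) (hβs : ∀ X Y, βb X Y = βb Y X) (hβ0 : ∀ X Y, 0 ≤ βb X Y) (hdcs : ∀ X Y, dc X Y = dc Y X) (hdc0 : ∀ X Y, 0 ≤ dc X Y)
    {σ ℓ ε S₀ S₁ S₂ : ℝ} (hℓ : 0 ≤ ℓ) (hε : 0 ≤ ε)
    (hLip : ∀ X Y, ∑ b, (g b X - g b Y) ^ 2 ≤ ℓ ^ 2 * dc X Y ^ 2) (hδ : ∀ i, ∑ b, δ b i ^ 2 ≤ ε ^ 2)
    (hA : ∀ (X Y : β) (u w : n → ℂ),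
      ‖∑ i ∈ univ.filter (fun i => blk i = X), ∑ k ∈ univ.filter (fun k => blk k = Y), star (u i) * A i k * w k‖
        ≤ βb X Y * Real.sqrt (∑ i ∈ univ.filter (fun i => blk i = X), ‖u i‖ ^ 2) * Real.sqrt (∑ k ∈ univ.filter (fun k => blk k = Y), ‖w k‖ ^ 2))
    (hS0 : ∀ X, ∑ Y, βb X Y ≤ S₀) (hS1 : ∀ X, ∑ Y, dc X Y * βb X Y ≤ S₁) (hS2 : ∀ X, ∑ Y, dc X Y ^ 2 * βb X Y ≤ S₂)
    (hblock : ∀ (b : B) (w : n → ℂ), (∀ i, g b (blk i) + δ b i = 0 → w i = 0) → σ * ∑ i, ‖w i‖ ^ 2 ≤ (∑ i, star (w i) * (A *ᵥ w) i).re)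
    (v : n → ℂ) :
    (σ - (ℓ ^ 2 * S₂ + 4 * ℓ * ε * S₁ + 4 * ε ^ 2 * S₀) / 2) * ∑ i, ‖v i‖ ^ 2 ≤ (∑ i, star (v i) * (A *ᵥ v) i).re := by
  refine ims_lowerBound_complex A (fun b i => g b (blk i) + δ b i) hpart hblock (fun w => ?_) v
  have := norm_imsError_le_of_blockBound_perturbed A blk g δ dc βb hβs hβ0 hdcs hdc0 hℓ hε hLip hδ hA hS0 hS1 hS2 w
  linarith

end Summit.QuantumFields.YangMills.Theorems.Prop7IMSDoubleCommutatorPerturbedBlock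

end
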